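import Summits.CriticalPhenomena.PercolationContinuityZ3.Theorems.PercNearOneGluingNearOneGluingQ7ThreeCutAux
import HarnessLib

/-!
# `NoHeavyLowerTail` (stmt-CriticalPhenomena-4575) — Kozma–Nitzan Question 7 for three relays:
# the `R5` lower bound for the Question-7 slack (four set-BHK inequalities)

Support file (`--supports stmt-CriticalPhenomena-4575`), coupling seat `prim-cplus-coupling` (gen 4).  No definitions,
no named facts, no sorries.

Setting: `μ = prodBernoulli w` on `Fin n`, observer `o`, target `b`, relays `x, y, z` (think `z` = the least
`b`-reliable relay of Kozma–Nitzan's Question 7, arXiv:2401.12397 p. 36, although THIS file needs no hypothesis on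
reliabilities), worlds `D = {z ↮ x} ∩ {z ↮ y}`, `E₁ = {x ↮ y} ∩ {x ↮ z}`, `E₂ = {y ↮ x} ∩ {y ↮ z}`, and the
Question-7 slack `pre := μ(o↔b, o↔A) − μ(z↔b, o↔A)`, `o↔A := {o↔x} ∪ {o↔y} ∪ {o↔z}`.

* `q7r5_decomp` — the cell decomposition behind the recipe:
  `μ(z↔b ∩ oA) + μ(P⁺) ≤ μ(o↔b ∩ oA) + μ(N₃) + μ(N₁) + μ(N₂)` with
  `P⁺ = D ∩ ({o↔x} ∪ {o↔y}) ∩ ({x↔b} ∪ {y↔b})`, `N₃ = D ∩ ({o↔x} ∪ {o↔y}) ∩ {z↔b}`,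
  `N₁ = E₂ ∩ {o↔y} ∩ {x↔b}`, `N₂ = E₁ ∩ {o↔x} ∩ {y↔b}` (pure case analysis on reachability).
* `q7r5_atoms` — the four van den Berg–Häggström–Kahn inequalities (tree theorem `stub_bhkSets`, i.e. BHK 2006
  Thms 1.3/1.4 for the cluster of a vertex SET): `μ(D∩o₁₂)μ(D∩b₁₂) ≤ μ(D)μ(P⁺)`, `μ(D)μ(N₃) ≤ μ(D∩o₁₂)μ(D∩zb)`,
  `μ(E₂)μ(N₁) ≤ μ(E₂∩oy)μ(E₂∩xb)`, `μ(E₁)μ(N₂) ≤ μ(E₁∩ox)μ(E₁∩yb)`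
  (`o₁₂ = {o↔x} ∪ {o↔y}`, `b₁₂ = {x↔b} ∪ {y↔b}`).
* `q7r5_level1` — hence the denominator-free form of  `pre ≥ R5`,
  `R5 := φ₁₂·[μ(D∩b₁₂) − μ(D∩zb)]/… − φ₂ μ(E₂∩xb) − φ₁ μ(E₁∩yb)` with `φ₁₂ = μ(D∩o₁₂)/μ(D)`,
  `φ₁ = μ(E₁∩ox)/μ(E₁)`, `φ₂ = μ(E₂∩oy)/μ(E₂)` (Kozma–Nitzan's `φ`'s):
  `(μ(ob∩oA) − μ(zb∩oA))·μ(D)μ(E₁)μ(E₂) ≥ μ(D∩o₁₂)(μ(D∩b₁₂) − μ(D∩zb))μ(E₁)μ(E₂)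
     − μ(E₂∩oy)μ(E₂∩xb)μ(D)μ(E₁) − μ(E₁∩ox)μ(E₁∩yb)μ(D)μ(E₂)`.
The companion file `…Q7ThreeStrongLemma2` turns this into an answer to Question 7 under an `o`-side condition;
compared with Kozma–Nitzan's Theorem 2 (six BHK steps) the positive cells are grouped in the world `D` with the event
`{b ∈ C(x) ∪ C(y)}` instead of `{x↔y↔b}` (seat memo A5-COUPLING-gen4.md: the two bounds are complementary).
[cite: KozmaNitzan2024, Question 7 (p. 36), Theorem 2 (pp. 8–9)] [cite: VandenbergHaggstromKahn2005, Thms 1.3–1.4]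
-/

namespace Summit.CriticalPhenomena.PercolationContinuityZ3.Theorems

open MeasureTheory Set Literature.Probability.LatticeModels Literature.Probability.Percolation
open scoped Classical BigOperators
open Q7ThreeCut

noncomputable section

namespace Q7ThreeRecipes

variable {V : Type*}

/-- The indicator of `{s ↔ a} ∪ {t ↔ c}` evaluated at an edge set `E` with `C_s(ω) ∪ C_t(ω) ⊆ E ⊆ ω` equals its
value at `ω`. [folklore] -/
theorem indicator_union_openConn_of_clusters {ω E : BondConfig V} {s t a c : V}
    (hs : openEdgeCluster ω s ⊆ E) (ht : openEdgeCluster ω t ⊆ E) (hEω : E ⊆ ω) :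
    (openConn s a ∪ openConn t c : Set (BondConfig V)).indicator (1 : BondConfig V → ℝ) E =
      (openConn s a ∪ openConn t c : Set (BondConfig V)).indicator (1 : BondConfig V → ℝ) ω := by
  have h1 := mem_openConn_iff_of_cluster_subset (a := a) hs hEω
  have h2 := mem_openConn_iff_of_cluster_subset (a := c) ht hEω
  by_cases h : ω ∈ (openConn s a ∪ openConn t c : Set (BondConfig V))
  · have hE : E ∈ (openConn s a ∪ openConn t c : Set (BondConfig V)) := by
      rcases h with h | h
      · exact Or.inl (h1.2 h)
      · exact Or.inr (h2.2 h)
    rw [indicator_of_mem h, indicator_of_mem hE]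
    simp only [Pi.one_apply]
  · have hE : E ∉ (openConn s a ∪ openConn t c : Set (BondConfig V)) := by
      rintro (h' | h')
      · exact h (Or.inl (h1.1 h'))
      · exact h (Or.inr (h2.1 h'))
    rw [indicator_of_notMem h, indicator_of_notMem hE]

end Q7ThreeRecipes

open Q7ThreeRecipes

variable {n : ℕ}

/-! ### The cell decomposition -/

/-- **Cell decomposition for the recipe `R5`.**  With `oA = {o↔x} ∪ {o↔y} ∪ {o↔z}`, `D = {x↮z} ∩ {y↮z}`,
`E₁ = {x↮y} ∩ {x↮z}`, `E₂ = {x↮y} ∩ {y↮z}`, `o₁₂ = {o↔x} ∪ {o↔y}`, `b₁₂ = {x↔b} ∪ {y↔b}`: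
`μ({z↔b} ∩ oA) + μ(D ∩ o₁₂ ∩ b₁₂) ≤ μ({o↔b} ∩ oA) + μ(D ∩ o₁₂ ∩ {z↔b}) + μ(E₂ ∩ {o↔y} ∩ {x↔b}) + μ(E₁ ∩ {o↔x} ∩ {y↔b})`.
Proof: `{z↔b} ∩ oA` and `P⁺ = D ∩ o₁₂ ∩ b₁₂` are disjoint and their union is contained in the union of the four
events on the right (on `P⁺` with `o ↮ b` the observer and `b` hang on different, separated relays among `x, y`;
on `{z↔b} ∩ oA` with `o ↮ b` the observer hangs on `x` or `y` while `b` hangs on `z`). [folklore] -/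
theorem q7r5_decomp (w : Sym2 (Fin n) → unitInterval) (o b x y z : Fin n) :
    (prodBernoulli w).real (openConn z b ∩ (openConn o x ∪ openConn o y ∪ openConn o z)) +
        (prodBernoulli w).real (((openConn x z)ᶜ ∩ (openConn y z)ᶜ) ∩ (openConn o x ∪ openConn o y) ∩
          (openConn x b ∪ openConn y b)) ≤
      (prodBernoulli w).real (openConn o b ∩ (openConn o x ∪ openConn o y ∪ openConn o z)) +
        (prodBernoulli w).real (((openConn x z)ᶜ ∩ (openConn y z)ᶜ) ∩ (openConn o x ∪ openConn o y) ∩ openConn z b) +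
        (prodBernoulli w).real (((openConn x y)ᶜ ∩ (openConn y z)ᶜ) ∩ openConn o y ∩ openConn x b) +
        (prodBernoulli w).real (((openConn x y)ᶜ ∩ (openConn x z)ᶜ) ∩ openConn o x ∩ openConn y b) := by
  set μ := prodBernoulli w with hμ
  set oA : Set (BondConfig (Fin n)) := openConn o x ∪ openConn o y ∪ openConn o z with hoA
  set D : Set (BondConfig (Fin n)) := (openConn x z)ᶜ ∩ (openConn y z)ᶜ with hD
  set Lz : Set (BondConfig (Fin n)) := openConn z b ∩ oA with hLz
  set Lo : Set (BondConfig (Fin n)) := openConn o b ∩ oA with hLo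
  set P : Set (BondConfig (Fin n)) := D ∩ (openConn o x ∪ openConn o y) ∩ (openConn x b ∪ openConn y b) with hP
  set N₃ : Set (BondConfig (Fin n)) := D ∩ (openConn o x ∪ openConn o y) ∩ openConn z b with hN₃
  set N₁ : Set (BondConfig (Fin n)) := ((openConn x y)ᶜ ∩ (openConn y z)ᶜ) ∩ openConn o y ∩ openConn x b with hN₁
  set N₂ : Set (BondConfig (Fin n)) := ((openConn x y)ᶜ ∩ (openConn x z)ᶜ) ∩ openConn o x ∩ openConn y b with hN₂
  -- `Lz` and `P` are disjoint: on `P`, `b` hangs on `x` or `y`, both separated from `z`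
  have hdisj : Disjoint Lz P := by
    rw [Set.disjoint_left]
    rintro ω ⟨hzb, -⟩ ⟨⟨⟨hxz, hyz⟩, -⟩, hb⟩
    rcases hb with hxb | hyb
    · exact hxz (conn_trans hxb (conn_symm hzb))
    · exact hyz (conn_trans hyb (conn_symm hzb))
  -- the union is covered by the four events on the right
  have hcover : Lz ∪ P ⊆ Lo ∪ N₃ ∪ N₁ ∪ N₂ := by
    intro ω hω
    by_cases hob : ω ∈ (openConn o b : Set (BondConfig (Fin n)))
    · rcases hω with ⟨-, hoA'⟩ | ⟨⟨-, ho⟩, -⟩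
      · exact Or.inl (Or.inl (Or.inl ⟨hob, hoA'⟩))
      · refine Or.inl (Or.inl (Or.inl ⟨hob, ?_⟩))
        rcases ho with h | h
        · exact Or.inl (Or.inl h)
        · exact Or.inl (Or.inr h)
    rcases hω with ⟨hzb, hoA'⟩ | ⟨⟨⟨hxz, hyz⟩, ho⟩, hb⟩
    · -- `z ↔ b`, `o ↔ A`, `o ↮ b`
      have hoz : ω ∉ (openConn o z : Set (BondConfig (Fin n))) := fun h => hob (conn_trans h hzb)
      have ho12 : ω ∈ (openConn o x ∪ openConn o y : Set (BondConfig (Fin n))) := by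
        rcases hoA' with (h | h) | h
        · exact Or.inl h
        · exact Or.inr h
        · exact absurd h hoz
      by_cases hxz : ω ∈ (openConn x z : Set (BondConfig (Fin n)))
      · -- `x ↔ z ↔ b`: then `o ↮ x`, so `o ↔ y`, `y` separated from `x, z`: `N₁`
        have hox : ω ∉ (openConn o x : Set (BondConfig (Fin n))) :=
          fun h => hob (conn_trans h (conn_trans hxz hzb))
        have hoy : ω ∈ (openConn o y : Set (BondConfig (Fin n))) := by
          rcases ho12 with h | h
          · exact absurd h hox
          · exact h
        have hxy : ω ∉ (openConn x y : Set (BondConfig (Fin n))) :=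
          fun h => hox (conn_trans hoy (conn_symm h))
        have hyz : ω ∉ (openConn y z : Set (BondConfig (Fin n))) :=
          fun h => hob (conn_trans hoy (conn_trans h hzb))
        exact Or.inl (Or.inr ⟨⟨⟨hxy, hyz⟩, hoy⟩, conn_trans hxz hzb⟩)
      · by_cases hyz : ω ∈ (openConn y z : Set (BondConfig (Fin n)))
        · -- `y ↔ z ↔ b`: then `o ↔ x`, `x` separated: `N₂`
          have hoy : ω ∉ (openConn o y : Set (BondConfig (Fin n))) :=
            fun h => hob (conn_trans h (conn_trans hyz hzb))
          have hox : ω ∈ (openConn o x : Set (BondConfig (Fin n))) := by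
            rcases ho12 with h | h
            · exact h
            · exact absurd h hoy
          have hxy : ω ∉ (openConn x y : Set (BondConfig (Fin n))) :=
            fun h => hoy (conn_trans hox h)
          exact Or.inr ⟨⟨⟨hxy, hxz⟩, hox⟩, conn_trans hyz hzb⟩
        · -- `z` separated from `x, y`: `N₃`
          exact Or.inl (Or.inl (Or.inr ⟨⟨⟨hxz, hyz⟩, ho12⟩, hzb⟩))
    · -- `ω ∈ P`, `o ↮ b`: `o` and `b` hang on different, separated relays among `x, y`
      rcases ho with hox | hoy
      · -- `o ↔ x`; then `b ↮ x`, so `b ↔ y`, and `x ↮ y`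
        have hxb : ω ∉ (openConn x b : Set (BondConfig (Fin n))) := fun h => hob (conn_trans hox h)
        have hyb : ω ∈ (openConn y b : Set (BondConfig (Fin n))) := by
          rcases hb with h | h
          · exact absurd h hxb
          · exact h
        have hxy : ω ∉ (openConn x y : Set (BondConfig (Fin n))) :=
          fun h => hxb (conn_trans h hyb)
        exact Or.inr ⟨⟨⟨hxy, hxz⟩, hox⟩, hyb⟩
      · have hyb : ω ∉ (openConn y b : Set (BondConfig (Fin n))) := fun h => hob (conn_trans hoy h)
        have hxb : ω ∈ (openConn x b : Set (BondConfig (Fin n))) := by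
          rcases hb with h | h
          · exact h
          · exact absurd h hyb
        have hxy : ω ∉ (openConn x y : Set (BondConfig (Fin n))) :=
          fun h => hyb (conn_trans (conn_symm h) hxb)
        exact Or.inl (Or.inr ⟨⟨⟨hxy, hyz⟩, hoy⟩, hxb⟩)
  -- measure bookkeeping
  have hunion : μ.real (Lz ∪ P) = μ.real Lz + μ.real P := measureReal_union hdisj MeasurableSet.of_discrete
  have h1 : μ.real (Lz ∪ P) ≤ μ.real (Lo ∪ N₃ ∪ N₁ ∪ N₂) := measureReal_mono hcover
  have h2 : μ.real (Lo ∪ N₃ ∪ N₁ ∪ N₂) ≤ μ.real (Lo ∪ N₃ ∪ N₁) + μ.real N₂ := measureReal_union_le _ _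
  have h3 : μ.real (Lo ∪ N₃ ∪ N₁) ≤ μ.real (Lo ∪ N₃) + μ.real N₁ := measureReal_union_le _ _
  have h4 : μ.real (Lo ∪ N₃) ≤ μ.real Lo + μ.real N₃ := measureReal_union_le _ _
  linarith

/-! ### The four BHK atoms -/

/-- **The four set-BHK inequalities of the recipe** (van den Berg–Häggström–Kahn 2006, Thms 1.3–1.4, for the open
cluster of a vertex set; tree theorem `stub_bhkSets`).  With the notation of `q7r5_decomp` and `x, y, z` distinct:
(1) `μ(D∩o₁₂)·μ(D∩b₁₂) ≤ μ(D)·μ(D∩o₁₂∩b₁₂)` (source set `{x,y}`, both events increasing in `C_x ∪ C_y`);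
(2) `μ(D)·μ(D∩o₁₂∩{z↔b}) ≤ μ(D∩o₁₂)·μ(D∩{z↔b})` (sets `{x,y}` and `{z}`);
(3) `μ(E₂)·μ(E₂∩{o↔y}∩{x↔b}) ≤ μ(E₂∩{o↔y})·μ(E₂∩{x↔b})` (sets `{y}` and `{x,z}`; `{x↔b}` is increasing in `C_x ∪ C_z`);
(4) `μ(E₁)·μ(E₁∩{o↔x}∩{y↔b}) ≤ μ(E₁∩{o↔x})·μ(E₁∩{y↔b})` (sets `{x}` and `{y,z}`).
[cite: VandenbergHaggstromKahn2005, Thms 1.3–1.4] -/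
theorem q7r5_atoms (w : Sym2 (Fin n) → unitInterval) (o b x y z : Fin n) (hxy : x ≠ y) (hxz : x ≠ z) (hyz : y ≠ z) :
    (prodBernoulli w).real (((openConn x z)ᶜ ∩ (openConn y z)ᶜ) ∩ (openConn o x ∪ openConn o y)) *
        (prodBernoulli w).real (((openConn x z)ᶜ ∩ (openConn y z)ᶜ) ∩ (openConn x b ∪ openConn y b)) ≤
      (prodBernoulli w).real ((openConn x z)ᶜ ∩ (openConn y z)ᶜ) *
        (prodBernoulli w).real (((openConn x z)ᶜ ∩ (openConn y z)ᶜ) ∩ (openConn o x ∪ openConn o y) ∩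
          (openConn x b ∪ openConn y b)) ∧
    (prodBernoulli w).real ((openConn x z)ᶜ ∩ (openConn y z)ᶜ) *
        (prodBernoulli w).real (((openConn x z)ᶜ ∩ (openConn y z)ᶜ) ∩ (openConn o x ∪ openConn o y) ∩ openConn z b) ≤
      (prodBernoulli w).real (((openConn x z)ᶜ ∩ (openConn y z)ᶜ) ∩ (openConn o x ∪ openConn o y)) *
        (prodBernoulli w).real (((openConn x z)ᶜ ∩ (openConn y z)ᶜ) ∩ openConn z b) ∧
    (prodBernoulli w).real ((openConn x y)ᶜ ∩ (openConn y z)ᶜ) *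
        (prodBernoulli w).real (((openConn x y)ᶜ ∩ (openConn y z)ᶜ) ∩ openConn o y ∩ openConn x b) ≤
      (prodBernoulli w).real (((openConn x y)ᶜ ∩ (openConn y z)ᶜ) ∩ openConn o y) *
        (prodBernoulli w).real (((openConn x y)ᶜ ∩ (openConn y z)ᶜ) ∩ openConn x b) ∧
    (prodBernoulli w).real ((openConn x y)ᶜ ∩ (openConn x z)ᶜ) *
        (prodBernoulli w).real (((openConn x y)ᶜ ∩ (openConn x z)ᶜ) ∩ openConn o x ∩ openConn y b) ≤
      (prodBernoulli w).real (((openConn x y)ᶜ ∩ (openConn x z)ᶜ) ∩ openConn o x) *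
        (prodBernoulli w).real (((openConn x y)ᶜ ∩ (openConn x z)ᶜ) ∩ openConn y b) := by
  set μ := prodBernoulli w with hμ
  obtain ⟨h13, h14⟩ := stub_bhkSets
  set F12 : Set (Sym2 (Fin n)) → ℝ := (openConn x o ∪ openConn y o : Set (BondConfig (Fin n))).indicator 1 with hF12
  set G12 : Set (Sym2 (Fin n)) → ℝ := (openConn x b ∪ openConn y b : Set (BondConfig (Fin n))).indicator 1 with hG12
  set Hz : Set (Sym2 (Fin n)) → ℝ := (openConn z b : Set (BondConfig (Fin n))).indicator 1 with hHz
  set Fy : Set (Sym2 (Fin n)) → ℝ := (openConn y o : Set (BondConfig (Fin n))).indicator 1 with hFy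
  set Gx : Set (Sym2 (Fin n)) → ℝ := (openConn x b : Set (BondConfig (Fin n))).indicator 1 with hGx
  set Fx : Set (Sym2 (Fin n)) → ℝ := (openConn x o : Set (BondConfig (Fin n))).indicator 1 with hFx
  set Gy : Set (Sym2 (Fin n)) → ℝ := (openConn y b : Set (BondConfig (Fin n))).indicator 1 with hGy
  have hup12o : IsUpperSet (openConn x o ∪ openConn y o : Set (BondConfig (Fin n))) :=
    (isUpperSet_openConn x o).union (isUpperSet_openConn y o)
  have hup12b : IsUpperSet (openConn x b ∪ openConn y b : Set (BondConfig (Fin n))) :=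
    (isUpperSet_openConn x b).union (isUpperSet_openConn y b)
  have hF12m : Monotone F12 := monotone_indicator_of_isUpperSet hup12o
  have hG12m : Monotone G12 := monotone_indicator_of_isUpperSet hup12b
  have hHzm : Monotone Hz := monotone_indicator_of_isUpperSet (isUpperSet_openConn z b)
  have hFym : Monotone Fy := monotone_indicator_of_isUpperSet (isUpperSet_openConn y o)
  have hGxm : Monotone Gx := monotone_indicator_of_isUpperSet (isUpperSet_openConn x b)
  have hFxm : Monotone Fx := monotone_indicator_of_isUpperSet (isUpperSet_openConn x o)
  have hGym : Monotone Gy := monotone_indicator_of_isUpperSet (isUpperSet_openConn y b)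
  have hxo : (openConn x o : Set (BondConfig (Fin n))) = openConn o x := by
    ext η; exact ⟨fun h => SimpleGraph.Reachable.symm h, fun h => SimpleGraph.Reachable.symm h⟩
  have hyo : (openConn y o : Set (BondConfig (Fin n))) = openConn o y := by
    ext η; exact ⟨fun h => SimpleGraph.Reachable.symm h, fun h => SimpleGraph.Reachable.symm h⟩
  have h12o : (openConn x o ∪ openConn y o : Set (BondConfig (Fin n))) = openConn o x ∪ openConn o y := by
    rw [hxo, hyo]
  have hCxy : ∀ ω : BondConfig (Fin n), (⋃ s ∈ ({x, y} : Finset (Fin n)), openEdgeCluster ω s) =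
      openEdgeCluster ω x ∪ openEdgeCluster ω y := by
    intro ω; rw [Finset.set_biUnion_insert, Finset.set_biUnion_singleton]
  have hCxz : ∀ ω : BondConfig (Fin n), (⋃ s ∈ ({x, z} : Finset (Fin n)), openEdgeCluster ω s) =
      openEdgeCluster ω x ∪ openEdgeCluster ω z := by
    intro ω; rw [Finset.set_biUnion_insert, Finset.set_biUnion_singleton]
  have hCyz : ∀ ω : BondConfig (Fin n), (⋃ s ∈ ({y, z} : Finset (Fin n)), openEdgeCluster ω s) =
      openEdgeCluster ω y ∪ openEdgeCluster ω z := by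
    intro ω; rw [Finset.set_biUnion_insert, Finset.set_biUnion_singleton]
  have hCx : ∀ ω : BondConfig (Fin n), (⋃ s ∈ ({x} : Finset (Fin n)), openEdgeCluster ω s) = openEdgeCluster ω x :=
    fun ω => Finset.set_biUnion_singleton x _
  have hCy : ∀ ω : BondConfig (Fin n), (⋃ s ∈ ({y} : Finset (Fin n)), openEdgeCluster ω s) = openEdgeCluster ω y :=
    fun ω => Finset.set_biUnion_singleton y _
  have hCz : ∀ ω : BondConfig (Fin n), (⋃ s ∈ ({z} : Finset (Fin n)), openEdgeCluster ω s) = openEdgeCluster ω z :=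
    fun ω => Finset.set_biUnion_singleton z _
  have sub2 : ∀ (ω : BondConfig (Fin n)) (s t : Fin n), openEdgeCluster ω s ∪ openEdgeCluster ω t ⊆ ω :=
    fun ω s t => union_subset (openEdgeCluster_subset ω s) (openEdgeCluster_subset ω t)
  have eF12 : ∀ ω : BondConfig (Fin n), F12 (openEdgeCluster ω x ∪ openEdgeCluster ω y) =
      (openConn o x ∪ openConn o y : Set (BondConfig (Fin n))).indicator 1 ω := by
    intro ω
    rw [hF12, indicator_union_openConn_of_clusters subset_union_left subset_union_right (sub2 ω x y), h12o]
  have eG12 : ∀ ω : BondConfig (Fin n), G12 (openEdgeCluster ω x ∪ openEdgeCluster ω y) =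
      (openConn x b ∪ openConn y b : Set (BondConfig (Fin n))).indicator 1 ω := fun ω =>
    indicator_union_openConn_of_clusters subset_union_left subset_union_right (sub2 ω x y)
  have eHz : ∀ ω : BondConfig (Fin n), Hz (openEdgeCluster ω z) =
      (openConn z b : Set (BondConfig (Fin n))).indicator 1 ω := fun ω =>
    indicator_openConn_of_cluster_subset subset_rfl (openEdgeCluster_subset ω z)
  have eFy : ∀ ω : BondConfig (Fin n), Fy (openEdgeCluster ω y) =
      (openConn o y : Set (BondConfig (Fin n))).indicator 1 ω := by
    intro ω; rw [hFy, indicator_openConn_of_cluster_subset subset_rfl (openEdgeCluster_subset ω y), hyo]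
  have eFx : ∀ ω : BondConfig (Fin n), Fx (openEdgeCluster ω x) =
      (openConn o x : Set (BondConfig (Fin n))).indicator 1 ω := by
    intro ω; rw [hFx, indicator_openConn_of_cluster_subset subset_rfl (openEdgeCluster_subset ω x), hxo]
  have eGx : ∀ ω : BondConfig (Fin n), Gx (openEdgeCluster ω x ∪ openEdgeCluster ω z) =
      (openConn x b : Set (BondConfig (Fin n))).indicator 1 ω := fun ω =>
    indicator_openConn_of_cluster_subset subset_union_left (sub2 ω x z)
  have eGy : ∀ ω : BondConfig (Fin n), Gy (openEdgeCluster ω y ∪ openEdgeCluster ω z) =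
      (openConn y b : Set (BondConfig (Fin n))).indicator 1 ω := fun ω =>
    indicator_openConn_of_cluster_subset subset_union_left (sub2 ω y z)
  have prod_ind : ∀ (A B : Set (BondConfig (Fin n))) (ω : BondConfig (Fin n)),
      A.indicator (1 : BondConfig (Fin n) → ℝ) ω * B.indicator 1 ω = (A ∩ B).indicator 1 ω := fun A B ω =>
    (congrFun (inter_indicator_one (s := A) (t := B) (M₀ := ℝ)) ω).symm
  have hDset : {ω : BondConfig (Fin n) | ∀ s ∈ ({x, y} : Finset (Fin n)), ∀ t ∈ ({z} : Set (Fin n)),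
      ¬ (openGraph ω).Reachable s t} = (openConn x z)ᶜ ∩ (openConn y z)ᶜ := by
    ext ω
    simp only [mem_setOf_eq, Finset.mem_insert, Finset.mem_singleton, forall_eq_or_imp, forall_eq,
      mem_singleton_iff, mem_inter_iff, mem_compl_iff]
    rfl
  have hDfin : {ω : BondConfig (Fin n) | ∀ s ∈ ({x, y} : Finset (Fin n)), ∀ t ∈ ({z} : Finset (Fin n)),
      ¬ (openGraph ω).Reachable s t} = (openConn x z)ᶜ ∩ (openConn y z)ᶜ := by
    ext ω
    simp only [mem_setOf_eq, Finset.mem_insert, Finset.mem_singleton, forall_eq_or_imp, forall_eq,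
      mem_inter_iff, mem_compl_iff]
    rfl
  have hE2fin : {ω : BondConfig (Fin n) | ∀ s ∈ ({y} : Finset (Fin n)), ∀ t ∈ ({x, z} : Finset (Fin n)),
      ¬ (openGraph ω).Reachable s t} = (openConn x y)ᶜ ∩ (openConn y z)ᶜ := by
    ext ω
    simp only [mem_setOf_eq, Finset.mem_singleton, forall_eq, Finset.mem_insert, forall_eq_or_imp,
      mem_inter_iff, mem_compl_iff]
    exact and_congr (not_congr ⟨SimpleGraph.Reachable.symm, SimpleGraph.Reachable.symm⟩) Iff.rfl
  have hE1fin : {ω : BondConfig (Fin n) | ∀ s ∈ ({x} : Finset (Fin n)), ∀ t ∈ ({y, z} : Finset (Fin n)),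
      ¬ (openGraph ω).Reachable s t} = (openConn x y)ᶜ ∩ (openConn x z)ᶜ := by
    ext ω
    simp only [mem_setOf_eq, Finset.mem_singleton, forall_eq, Finset.mem_insert, forall_eq_or_imp,
      mem_inter_iff, mem_compl_iff]
    rfl
  refine ⟨?_, ?_, ?_, ?_⟩
  · -- (1): Thm 1.3 for the set `{x,y}` and `X = {z}`
    have key := h13 n w {x, y} ({z} : Set (Fin n)) F12 G12 hF12m hG12m (by
      intro s hs
      simp only [Finset.mem_insert, Finset.mem_singleton] at hs
      simp only [mem_singleton_iff]
      rcases hs with rfl | rfl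
      · exact hxz
      · exact hyz)
    simp only [hDset, hCxy] at key
    simp only [eF12, eG12, prod_ind, setIntegral_indicator_one_eq] at key
    simpa only [inter_assoc] using key
  · -- (2): Thm 1.4 for `{x,y}` and `{z}`
    have key := h14 n w {x, y} {z} F12 Hz hF12m hHzm (by
      simp only [Finset.disjoint_insert_left, Finset.mem_singleton, Finset.disjoint_singleton_left]
      exact ⟨hxz, hyz⟩)
    simp only [hDfin, hCxy, hCz] at key
    simp only [eF12, eHz, prod_ind, setIntegral_indicator_one_eq] at key
    simpa only [inter_assoc] using key
  · -- (3): Thm 1.4 for `{y}` and `{x,z}`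
    have key := h14 n w {y} {x, z} Fy Gx hFym hGxm (by
      simp only [Finset.disjoint_singleton_left, Finset.mem_insert, Finset.mem_singleton, not_or]
      exact ⟨Ne.symm hxy, hyz⟩)
    simp only [hE2fin, hCy, hCxz] at key
    simp only [eFy, eGx, prod_ind, setIntegral_indicator_one_eq] at key
    simpa only [inter_assoc] using key
  · -- (4): Thm 1.4 for `{x}` and `{y,z}`
    have key := h14 n w {x} {y, z} Fx Gy hFxm hGym (by
      simp only [Finset.disjoint_singleton_left, Finset.mem_insert, Finset.mem_singleton, not_or]
      exact ⟨hxy, hxz⟩)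
    simp only [hE1fin, hCx, hCyz] at key
    simp only [eFx, eGy, prod_ind, setIntegral_indicator_one_eq] at key
    simpa only [inter_assoc] using key

/-! ### Level 1: `pre ≥ R5` in denominator-free form -/

/-- **The `R5` lower bound for the Question-7 slack (denominator-free).**  For distinct relays `x, y, z`, with
`D = {x↮z} ∩ {y↮z}`, `E₁ = {x↮y} ∩ {x↮z}`, `E₂ = {x↮y} ∩ {y↮z}`, `oA = {o↔x} ∪ {o↔y} ∪ {o↔z}`:
`(μ(ob ∩ oA) − μ(zb ∩ oA))·μ(D)μ(E₁)μ(E₂) ≥ μ(D∩o₁₂)·(μ(D∩b₁₂) − μ(D∩zb))·μ(E₁)μ(E₂)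
  − μ(E₂∩oy)μ(E₂∩xb)·μ(D)μ(E₁) − μ(E₁∩ox)μ(E₁∩yb)·μ(D)μ(E₂)`,
i.e. `pre ≥ φ₁₂[μ(D∩b₁₂) − μ(D∩zb)] − φ₂ μ(E₂∩xb) − φ₁ μ(E₁∩yb)` after dividing by `μ(D)μ(E₁)μ(E₂)`
(`φ₁₂ = μ(o ↔ {x,y} | D)`, `φ₁ = μ(o↔x | E₁)`, `φ₂ = μ(o↔y | E₂)`, Kozma–Nitzan's coefficients).
Proof: `q7r5_decomp` and the four atoms `q7r5_atoms`.
[cite: KozmaNitzan2024, Question 7 (p. 36), Lemma 1 (p. 5)] [cite: VandenbergHaggstromKahn2005, Thms 1.3–1.4] -/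
theorem q7r5_level1 (w : Sym2 (Fin n) → unitInterval) (o b x y z : Fin n) (hxy : x ≠ y) (hxz : x ≠ z) (hyz : y ≠ z) :
    (prodBernoulli w).real (((openConn x z)ᶜ ∩ (openConn y z)ᶜ) ∩ (openConn o x ∪ openConn o y)) *
          ((prodBernoulli w).real (((openConn x z)ᶜ ∩ (openConn y z)ᶜ) ∩ (openConn x b ∪ openConn y b)) -
            (prodBernoulli w).real (((openConn x z)ᶜ ∩ (openConn y z)ᶜ) ∩ openConn z b)) *
          (prodBernoulli w).real ((openConn x y)ᶜ ∩ (openConn x z)ᶜ) *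
          (prodBernoulli w).real ((openConn x y)ᶜ ∩ (openConn y z)ᶜ) -
        (prodBernoulli w).real (((openConn x y)ᶜ ∩ (openConn y z)ᶜ) ∩ openConn o y) *
          (prodBernoulli w).real (((openConn x y)ᶜ ∩ (openConn y z)ᶜ) ∩ openConn x b) *
          (prodBernoulli w).real ((openConn x z)ᶜ ∩ (openConn y z)ᶜ) *
          (prodBernoulli w).real ((openConn x y)ᶜ ∩ (openConn x z)ᶜ) -
        (prodBernoulli w).real (((openConn x y)ᶜ ∩ (openConn x z)ᶜ) ∩ openConn o x) *
          (prodBernoulli w).real (((openConn x y)ᶜ ∩ (openConn x z)ᶜ) ∩ openConn y b) *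
          (prodBernoulli w).real ((openConn x z)ᶜ ∩ (openConn y z)ᶜ) *
          (prodBernoulli w).real ((openConn x y)ᶜ ∩ (openConn y z)ᶜ) ≤
      ((prodBernoulli w).real (openConn o b ∩ (openConn o x ∪ openConn o y ∪ openConn o z)) -
          (prodBernoulli w).real (openConn z b ∩ (openConn o x ∪ openConn o y ∪ openConn o z))) *
        (prodBernoulli w).real ((openConn x z)ᶜ ∩ (openConn y z)ᶜ) *
        (prodBernoulli w).real ((openConn x y)ᶜ ∩ (openConn x z)ᶜ) *
        (prodBernoulli w).real ((openConn x y)ᶜ ∩ (openConn y z)ᶜ) := by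
  obtain ⟨a1, a2, a3, a4⟩ := q7r5_atoms w o b x y z hxy hxz hyz
  have dec := q7r5_decomp w o b x y z
  set μ := prodBernoulli w with hμ
  set pD := μ.real ((openConn x z)ᶜ ∩ (openConn y z)ᶜ) with hpD
  set pE1 := μ.real ((openConn x y)ᶜ ∩ (openConn x z)ᶜ) with hpE1
  set pE2 := μ.real ((openConn x y)ᶜ ∩ (openConn y z)ᶜ) with hpE2
  set oD := μ.real (((openConn x z)ᶜ ∩ (openConn y z)ᶜ) ∩ (openConn o x ∪ openConn o y)) with hoD
  set b12 := μ.real (((openConn x z)ᶜ ∩ (openConn y z)ᶜ) ∩ (openConn x b ∪ openConn y b)) with hb12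
  set b3 := μ.real (((openConn x z)ᶜ ∩ (openConn y z)ᶜ) ∩ openConn z b) with hb3
  set P := μ.real (((openConn x z)ᶜ ∩ (openConn y z)ᶜ) ∩ (openConn o x ∪ openConn o y) ∩
    (openConn x b ∪ openConn y b)) with hP
  set N3 := μ.real (((openConn x z)ᶜ ∩ (openConn y z)ᶜ) ∩ (openConn o x ∪ openConn o y) ∩ openConn z b) with hN3
  set o2 := μ.real (((openConn x y)ᶜ ∩ (openConn y z)ᶜ) ∩ openConn o y) with ho2
  set xb2 := μ.real (((openConn x y)ᶜ ∩ (openConn y z)ᶜ) ∩ openConn x b) with hxb2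
  set N1 := μ.real (((openConn x y)ᶜ ∩ (openConn y z)ᶜ) ∩ openConn o y ∩ openConn x b) with hN1
  set o1 := μ.real (((openConn x y)ᶜ ∩ (openConn x z)ᶜ) ∩ openConn o x) with ho1
  set yb1 := μ.real (((openConn x y)ᶜ ∩ (openConn x z)ᶜ) ∩ openConn y b) with hyb1
  set N2 := μ.real (((openConn x y)ᶜ ∩ (openConn x z)ᶜ) ∩ openConn o x ∩ openConn y b) with hN2
  set Lo := μ.real (openConn o b ∩ (openConn o x ∪ openConn o y ∪ openConn o z)) with hLo
  set Lz := μ.real (openConn z b ∩ (openConn o x ∪ openConn o y ∪ openConn o z)) with hLz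
  have h0D : 0 ≤ pD := measureReal_nonneg
  have h0E1 : 0 ≤ pE1 := measureReal_nonneg
  have h0E2 : 0 ≤ pE2 := measureReal_nonneg
  -- `dec : Lz + P ≤ Lo + N3 + N1 + N2`; multiply by `pD pE1 pE2`
  have hPos : 0 ≤ pD * pE1 * pE2 := mul_nonneg (mul_nonneg h0D h0E1) h0E2
  have step0 : (P - N3 - N1 - N2) * (pD * pE1 * pE2) ≤ (Lo - Lz) * (pD * pE1 * pE2) :=
    mul_le_mul_of_nonneg_right (by linarith) hPos
  -- atoms, multiplied by the complementary nonnegative factors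
  have s1 : oD * b12 * (pE1 * pE2) ≤ pD * P * (pE1 * pE2) :=
    mul_le_mul_of_nonneg_right a1 (mul_nonneg h0E1 h0E2)
  have s2 : pD * N3 * (pE1 * pE2) ≤ oD * b3 * (pE1 * pE2) :=
    mul_le_mul_of_nonneg_right a2 (mul_nonneg h0E1 h0E2)
  have s3 : pE2 * N1 * (pD * pE1) ≤ o2 * xb2 * (pD * pE1) :=
    mul_le_mul_of_nonneg_right a3 (mul_nonneg h0D h0E1)
  have s4 : pE1 * N2 * (pD * pE2) ≤ o1 * yb1 * (pD * pE2) :=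
    mul_le_mul_of_nonneg_right a4 (mul_nonneg h0D h0E2)
  nlinarith [step0, s1, s2, s3, s4]

end

end Summit.CriticalPhenomena.PercolationContinuityZ3.Theorems
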